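import Literature.Topology.FourManifolds.TautFoliationsGluing
import Literature.Topology.FourManifolds.TautFoliationsProductSpheres
import Literature.Topology.FourManifolds.DehnSurgeryUniquenessProofs
import Literature.Topology.FourManifolds.DehnSurgeryUnknotZeroProofs
import Literature.Topology.FourManifolds.SliceGenusUnknotLeaves
import Literature.Topology.FourManifolds.KnotsProofs
import HarnessLib

/-!
# Gabai's Corollary 8.2 in genus `0` (unknotted `k`), proved

Sibling of `TautFoliations.lean`, which vendors D. Gabai, *Foliations and the topology of
3-manifolds. III*, J. Differential Geom. 26 (1987), Cor. 8.2 (pp. 524–525) as the named fact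
`Literature.Topology.FourManifolds.Knot.exists_isTaut_hasCompactLeafOfGenus_of_isIntegralSurgery_zero`:
zero frame surgery on a knot `k ⊆ S³` of (minimal Seifert) genus `g` carries a transversely
oriented taut `C⁰` codimension-one foliation with a compact leaf of genus `g`. The printed proof is
Gabai's Theorem 3.1 (the main theorem of that paper: sutured manifold hierarchies give a taut
finite depth foliation of the knot exterior `S³ - N̊(k)`, by longitudes on `∂N(k)`, with the minimal
genus Seifert surface as a leaf; §§3–7) followed by capping off the boundary circles by the meridian
discs of the filling (p. 525); no ingredient of Theorem 3.1 (sutured manifolds, the Thurston norm,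
disc decompositions and the foliations built from them, Gabai I §§2–5) exists in Mathlib or in
`Literature/`, so the general statement stays a cited named fact.

This file proves the statement **in the case genus `k = 0`**, where everything it needs is a theorem
of the tree:

* `Literature.Topology.FourManifolds.Knot.exists_isTaut_hasCompactLeafOfGenus_zero_of_isUnknot`
  (**proved**): if `K` is unknotted and the manifold `M` (any real model, any universe) is a
  `0`-surgery on `K`, then `M` carries a transversely oriented taut `C⁰` codimension-one foliation
  with a compact leaf of genus `0`. Proof: `S² × S¹` is a `0`-surgery on the unknot
  (`isIntegralSurgery_unknot_zero_holds`, Rolfsen (1976), §9.G Example 3), surgery on isotopic knots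
  with equal framings gives diffeomorphic manifolds (`nonempty_diffeomorph_of_isIntegralSurgery_holds`,
  Gompf–Stipsicz (1999), §5.3), so `M ≃ₜ S² × S¹`; transport the product foliation by spheres
  (`Foliation.productSpheres`: transversely oriented, taut, every leaf a sphere —
  `TautFoliationsProductSpheres.lean`) along the homeomorphism (`Foliation.map` and its transport
  lemmas, `TautFoliationsGluing.lean`). This is Cor. 8.2 for the unknot read literally: the minimal
  genus Seifert surface is a disc `D`, the exterior `S³ - N̊(k) = D² × S¹` is foliated by the meridian
  discs parallel to `D` (longitudes on the boundary), and capping off gives the spheres `S² × {θ}` of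
  `M = S² × S¹`, the core of the filling `{pt} × S¹` meeting every leaf.
* `Literature.Topology.FourManifolds.Knot.exists_isTaut_hasCompactLeafOfGenus_of_isIntegralSurgery_zero_of_genus_zero`
  (**proved**): the named fact's own binder list at `g = 0` — if `0` is the least genus of a Seifert
  surface of `K` (i.e. `K` bounds a smoothly embedded disc) then every `0`-surgery on `K` carries such
  a foliation with a compact leaf of genus `0`; by "a knot bounding a disc is unknotted"
  (`Knot.isUnknot_iff_hasSeifertSurfaceOfGenus_zero`, `SliceGenusUnknotLeaves.lean`; Cromwell (2004),
  Ch. 5, p. 103) and the previous theorem.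

So the slice `g = 0` of the named fact is a theorem, and the three vendored predicates
(`IsTransverselyOriented`, `IsTaut`, `HasCompactLeafOfGenus`) are jointly realised on actual zero
surgeries in every model and universe; the slices `g ≥ 1` are Gabai's theorem proper.
No definitions and no named facts are introduced.

## References

* D. Gabai, *Foliations and the topology of 3-manifolds. III*, J. Differential Geom. 26 (1987)
  479–536, Thm. 3.1 (p. 481), Cor. 8.2 and its proof (pp. 524–525) [GabaiJDG1987].
* D. Rolfsen, *Knots and Links* (1976), §9.G Example 3 (`0`-surgery on the unknot is `S² × S¹`)
  [Rolfsen1976].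
* R. Gompf, A. Stipsicz, *4-Manifolds and Kirby Calculus* (1999), §5.3 (Dehn surgery, uniqueness)
  [GompfStipsicz1999].
* P. Cromwell, *Knots and Links* (2004), Ch. 5, p. 103 (a knot spanned by a disc is trivial)
  [Cromwell2004].

## Design notes

* The leaf model is `𝔼 2` and the foliation is the `C⁰` notion of `TautFoliations.lean`; only the
  topology of `M` enters (through the homeomorphism underlying the diffeomorphism `M ≃ S² × S¹`), so
  the model with corners `IM` and the universe of `M` are arbitrary, exactly as in the named fact.
* Notation `𝔼 n`, `𝕊 n` is local, as in the sibling files.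
-/

open scoped Manifold ContDiff Topology
open Function Set

noncomputable section

universe u

namespace Literature.Topology.FourManifolds

/-- Local notation: `𝔼 n` is the model Euclidean space `EuclideanSpace ℝ (Fin n)`. -/
local notation "𝔼 " n:arg => EuclideanSpace ℝ (Fin n)

/-- Local notation: `𝕊 n` is the unit sphere in `EuclideanSpace ℝ (Fin (n + 1))`, the standard
`n`-sphere with its Mathlib manifold structure. -/
local notation "𝕊 " n:arg => (Metric.sphere (0 : EuclideanSpace ℝ (Fin (n + 1))) 1)

namespace Knot

/-- **Gabai's Corollary 8.2 for an unknotted `k`** (J. Differential Geom. 26 (1987), Cor. 8.2,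
pp. 524–525, case genus `k = 0`): if `K` is unknotted and `M` (a smooth manifold on any real model,
in any universe) is a `0`-surgery on `K`, then `M` carries a transversely oriented taut `C⁰`
codimension-one foliation with a compact leaf of genus `0`. Proof: `S² × S¹` is a `0`-surgery on
the unknot (`isIntegralSurgery_unknot_zero_holds`, Rolfsen §9.G Ex. 3) and `0`-surgeries on isotopic
knots are diffeomorphic (`nonempty_diffeomorph_of_isIntegralSurgery_holds`, Gompf–Stipsicz §5.3), so
`M ≃ₜ S² × S¹`; the product foliation by the spheres `S² × {θ}` is transversely oriented and taut
with compact leaves of genus `0`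
(`Foliation.productSpheres_isTransverselyOriented_isTaut_hasCompactLeafOfGenus_zero`), and these
properties are transported along the homeomorphism (`Foliation.map`, `Foliation.isTaut_map`,
`Foliation.isTransverselyOriented_map`, `Foliation.HasCompactLeafOfGenus.map`). In Gabai's terms: the
exterior of the unknot is `D² × S¹` foliated by meridian discs (longitudes on `∂N(k)`, the spanning
disc a leaf), and capping off gives the spheres of `S² × S¹`, met by the core of the filling.
[cite: GabaiJDG1987, Cor. 8.2 (case genus 0)] [cite: Rolfsen1976, §9.G Example 3] -/
theorem exists_isTaut_hasCompactLeafOfGenus_zero_of_isUnknot (K : Knot) (hK : K.IsUnknot)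
    {EM HM : Type} [NormedAddCommGroup EM] [NormedSpace ℝ EM] [TopologicalSpace HM]
    (IM : ModelWithCorners ℝ EM HM) (M : Type u) [TopologicalSpace M] [ChartedSpace HM M]
    [IsManifold IM ∞ M] (h : IsIntegralSurgery IM M K 0) :
    ∃ F : Foliation (𝔼 2) M, F.IsTransverselyOriented ∧ F.IsTaut ∧ F.HasCompactLeafOfGenus 0 := by
  -- `M` and `S² × S¹` are `0`-surgeries on the isotopic knots `K`, `unknot`
  obtain ⟨e⟩ := nonempty_diffeomorph_of_isIntegralSurgery_holds (IY := IM) (Y := M) hK h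
    isIntegralSurgery_unknot_zero_holds
  -- transport the product foliation by spheres along `S² × S¹ ≃ₜ M`
  let φ : (𝕊 2) × (𝕊 1) ≃ₜ M := e.toHomeomorph.symm
  obtain ⟨ho, ht, hg⟩ :=
    Foliation.productSpheres_isTransverselyOriented_isTaut_hasCompactLeafOfGenus_zero
  exact ⟨Foliation.productSpheres.map φ, Foliation.isTransverselyOriented_map _ φ ho,
    Foliation.isTaut_map _ φ ht, Foliation.HasCompactLeafOfGenus.map _ φ hg⟩

/-- **The genus-`0` slice of the named fact
`Knot.exists_isTaut_hasCompactLeafOfGenus_of_isIntegralSurgery_zero`** (Gabai (1987), Cor. 8.2,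
case genus `k = 0`), with that fact's binders: if `0` is the least genus of a Seifert surface for
`K` — i.e. `K` bounds a smoothly embedded disc in `𝕊 3` — then every `0`-surgery `M` on `K` (any
model, any universe) carries a transversely oriented taut `C⁰` codimension-one foliation with a
compact leaf of genus `0`. A knot bounding a disc is unknotted
(`Knot.isUnknot_iff_hasSeifertSurfaceOfGenus_zero`; Cromwell (2004), Ch. 5, p. 103), and the
unknotted case is `exists_isTaut_hasCompactLeafOfGenus_zero_of_isUnknot`. The slices `g ≥ 1` are
Gabai's Theorem 3.1 (sutured manifold theory) and are not available.
[cite: GabaiJDG1987, Cor. 8.2 (case genus 0)] [cite: Cromwell2004, Ch. 5 p. 103] -/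
theorem exists_isTaut_hasCompactLeafOfGenus_of_isIntegralSurgery_zero_of_genus_zero (K : Knot)
    (hg : IsLeast {g | K.HasSeifertSurfaceOfGenus g} 0)
    {EM HM : Type} [NormedAddCommGroup EM] [NormedSpace ℝ EM] [TopologicalSpace HM]
    (IM : ModelWithCorners ℝ EM HM) (M : Type u) [TopologicalSpace M] [ChartedSpace HM M]
    [IsManifold IM ∞ M] (h : IsIntegralSurgery IM M K 0) :
    ∃ F : Foliation (𝔼 2) M, F.IsTransverselyOriented ∧ F.IsTaut ∧ F.HasCompactLeafOfGenus 0 :=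
  exists_isTaut_hasCompactLeafOfGenus_zero_of_isUnknot K
    ((isUnknot_iff_hasSeifertSurfaceOfGenus_zero K).2 hg.1) IM M h

end Knot

end Literature.Topology.FourManifolds
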